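import Literature.NumberTheory.Automorphic.JacquetModuleFrobeniusProofs                    -- ★ `normalizedJacquetLift` (ev₁ descends to `r_P`, the `δ^{±1/2}` cancel)
import Summits.HodgeConjecture.HodgeConjecture.Theorems.F0P2nBorelCharactersUnipotent   -- ★ `deltaChar_cmBorel_eq_one` (`δ_B|_N = 1` for `U(Φ₃)(L⁺_v)`)
import HarnessLib

/-!
# `F0P3U3PrincipalSeriesJacquetClosedCell` — the CLOSED-CELL HALF of the Jacquet module of `i_G(χ)` for `U(3)`
# (upper-bound half of [Casselman1995] Lemma 7.1.1 (a), part 1 of 2; N1 head start)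

Cell `hodgecm-mathlib`, F0∕P3 topic T3 (Keys `KeysCaseTwo` pay-down), node N1 = ★ named fact
`UnitaryGroup.U3PrincipalSeriesJacquetFiltration L` (`Automorphic/U3PrincipalSeriesJacquetFiltration.lean`): «`r_B i_G(χ)`
has dimension `2`, with a `T`-stable line `ℓ` on which `T` acts through `wχ` and modulo which `T` acts through `χ`».
This file is the FIRST of two helper files towards the UPPER-BOUND half of that fact (typ-T3b «=» 16:06Z): the line
`ℓ` is typed as the KERNEL of the evaluation-at-`1` functional on the normalised Jacquet module, and everything about
the QUOTIENT `r ⧸ ℓ` is proved; the second file (open cell) bounds `ℓ` itself.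

WHAT IS PROVED (theorems + three `def`s with bodies; no `sorry`, no instance, no notation).
* §1 GENERIC (`G` a topological group, `t = (P, M, N)` a parabolic triple with `P` locally compact and `δ_P|_N = 1`,
  `σ` a representation of `M` on `W`): `evalOneP` = evaluation at `1`, `i_P σ|_P → σ ∘ proj ⊗ δ_P^{1/2}` (Frobenius image
  of the identity, ★ `frobeniusMap`); **`evalJacquet : r_P (i_P σ) → σ`**, the `M`-intertwining map it induces on the
  NORMALISED Jacquet module (★ `normalizedJacquetLift`: the factors `δ_P^{∓1/2}` cancel), `evalJacquet [f] = f(1)`;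
  **`evalJacquetKer`** `= ℓ := ker evalJacquet`, stable under `r_P` (`normalizedJacquet_mem_evalJacquetKer`); membership
  `x ∈ ℓ ↔ x = [f]` for some `f` with `f(1) = 0` (`mem_evalJacquetKer_iff`) — and `f(1) = 0 ⇔ f|_P = 0` (`toFun_eq_zero_of_mem`,
  the closed cell); `r ⧸ ℓ ↪ W` so `dim (r ⧸ ℓ) ≤ dim W` (`finrank_quotient_evalJacquetKer_le`); for `σ = 𝟙 ⊗ χ` a CHARACTER:
  **`normalizedJacquet m x − χ(m) • x ∈ ℓ`** (`normalizedJacquet_sub_smul_mem_evalJacquetKer`) — `M` acts on `r ⧸ ℓ` through `χ`.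
* §2 THE CM INSTANCE `G = U(Φ₃)(L⁺_v)`, `B = TN` = ★ `cmBorelTriple L 3 v`, `i_G(χ)` = ★ `cmPrincipalSeries L 3 v χ` (any character
  `χ` of `T(L⁺_v)`, any finite place `v`; `δ_B|_N = 1` is ★ `deltaChar_cmBorel_eq_one`): **`closedCell_cmPrincipalSeries`** — there is
  a `T`-stable `ℓ ≤ r_B i_G(χ)` with `r(m) x − χ(m) x ∈ ℓ` for all `m, x`, `FiniteDimensional (r ⧸ ℓ)`, `finrank (r ⧸ ℓ) ≤ 1`,
  and `ℓ` = the classes of the functions vanishing at `1` (equivalently on `B`) — i.e. clauses (β) and half of (γ) of the N1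
  text with `ℓ := evalJacquetKer`, over the fact's literal carrier `↥(unitaryGroupOfForm (conjLocal L c v) (cmLocalForm L 3 v))`.
  What remains for N1 (file 2 + tomorrow): `finrank ℓ ≤ 1` with `T` acting on `ℓ` through `wχ` (open cell `B w₀ N`, ★
  `U3LocalBruhatDecomposition_holds`), and the two LOWER bounds `ℓ ≠ 0`, `r ⧸ ℓ ≠ 0`.

Print: [Casselman1995] §6.3 (the filtration of `Ind|_P` by Bruhat cells; the top quotient = restriction to the closed cell
`P`, on which `Ind ↦ σδ^{1/2}` by evaluation at `1`), Lemma 7.1.1 (a) p. 67 «`0 → (w⁻¹σ)δ_P^{1/2} → I_N → σδ_P^{1/2} → 0`»;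
[BernsteinZelevinsky1977] 1.9 (b) + §2.12 (the `δ^{1/2}` bookkeeping: in normalised terms the quotient is `σ` itself).
HONEST LABEL: HC_CM is proved only modulo the printed citations until rung 0 closes; this helper discharges nothing by itself.
-/

set_option autoImplicit false
set_option linter.dupNamespace false

noncomputable section

open Literature.NumberTheory.Automorphic

namespace Summit.HodgeConjecture.HodgeConjecture.Cruxes.H413.F0P3U3PrincipalSeriesJacquetClosedCell

/-! ## §1 Generic: evaluation at `1` on the normalised Jacquet module of `i_P σ` -/

section Generic

variable {G : Type*} [Group G] [TopologicalSpace G] [IsTopologicalGroup G]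
  (t : ParabolicTriple G) [LocallyCompactSpace t.P]
  {W : Type*} [AddCommGroup W] [Module ℂ W] (σ : Representation ℂ t.M W)

/-- **Evaluation at `1` as a `P`-map** `i_P σ|_P → σ ∘ proj ⊗ δ_P^{1/2}`, `f ↦ f(1)`: the image of the identity of `i_P σ`
under Frobenius reciprocity for smooth induction (★ `Representation.frobeniusMap`). [cite: BernsteinZelevinsky1976, Proposition 2.28]
[cite: Casselman1995, §6.3] -/
def evalOneP :
    Representation.IntertwiningMap ((Representation.normalizedInd t σ).comp t.P.subtype)
      (Representation.twist (σ.comp t.proj) (rootDeltaChar t.P)) :=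
  Representation.frobeniusMap t.P (Representation.twist (σ.comp t.proj) (rootDeltaChar t.P))
    (Representation.normalizedInd t σ) (Representation.IntertwiningMap.id _)

/-- `evalOneP f = f(1)`. [folklore] -/
@[simp] theorem evalOneP_apply
    (f : Representation.SmoothInd t.P (Representation.twist (σ.comp t.proj) (rootDeltaChar t.P))) :
    evalOneP t σ f = f.toFun 1 := rfl

variable (hδ : ∀ (n : G) (hn : n ∈ t.N), deltaChar t.P ⟨n, t.N_le hn⟩ = 1)

/-- **Evaluation at `1` on the normalised Jacquet module** `r_P (i_P σ) → σ`, an `M`-INTERTWINING map (the factors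
`δ_P^{-1/2}` of `r_P` and `δ_P^{1/2}` of `i_P` cancel; ★ `normalizedJacquetLift`, which needs `δ_P|_N = 1`).  Its image is the
closed-cell quotient `σ` of the geometric lemma. [cite: Casselman1995, Lemma 7.1.1 (a) p. 67; §6.3]
[cite: BernsteinZelevinsky1977, Proposition 1.9(b), p. 445] -/
def evalJacquet : ((Representation.normalizedInd t σ).normalizedJacquet t).IntertwiningMap σ :=
  Representation.normalizedJacquetLift hδ (evalOneP t σ)

/-- `evalJacquet [f] = f(1)`. [folklore] -/
@[simp] theorem evalJacquet_mk
    (f : Representation.SmoothInd t.P (Representation.twist (σ.comp t.proj) (rootDeltaChar t.P))) :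
    evalJacquet t σ hδ (Representation.Coinvariants.mk _ f) = f.toFun 1 := rfl

/-- `evalJacquet` intertwines the normalised Jacquet action with `σ`: `ev (r(m) x) = σ(m) (ev x)`.
[cite: BernsteinZelevinsky1977, Proposition 1.9(b), p. 445] -/
theorem evalJacquet_normalizedJacquet (m : t.M)
    (x : (t.restrict (Representation.normalizedInd t σ)).Coinvariants) :
    evalJacquet t σ hδ ((Representation.normalizedInd t σ).normalizedJacquet t m x) = σ m (evalJacquet t σ hδ x) :=
  Representation.IntertwiningMap.isIntertwining _ _ (evalJacquet t σ hδ) m x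

/-- **The closed-cell kernel** `ℓ := ker (ev : r_P (i_P σ) → σ)` — the classes of the functions vanishing on the closed
cell `P`. [cite: Casselman1995, §6.3; Lemma 7.1.1 (a) p. 67] -/
def evalJacquetKer : Submodule ℂ (t.restrict (Representation.normalizedInd t σ)).Coinvariants :=
  LinearMap.ker (evalJacquet t σ hδ).toLinearMap

/-- Membership in `ℓ`: `x ∈ ℓ ↔ ev x = 0`. [folklore] -/
theorem mem_evalJacquetKer_iff_apply (x : (t.restrict (Representation.normalizedInd t σ)).Coinvariants) :
    x ∈ evalJacquetKer t σ hδ ↔ evalJacquet t σ hδ x = 0 :=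
  LinearMap.mem_ker

/-- `ℓ` is stable under the (normalised) Jacquet action of `M`. [cite: Casselman1995, §6.3] -/
theorem normalizedJacquet_mem_evalJacquetKer (m : t.M)
    {x : (t.restrict (Representation.normalizedInd t σ)).Coinvariants} (hx : x ∈ evalJacquetKer t σ hδ) :
    (Representation.normalizedInd t σ).normalizedJacquet t m x ∈ evalJacquetKer t σ hδ := by
  rw [mem_evalJacquetKer_iff_apply] at hx ⊢
  rw [evalJacquet_normalizedJacquet, hx, map_zero]

/-- **`ℓ` is the image of the functions vanishing at `1`**: `x ∈ ℓ ↔ x = [f]` for some `f ∈ i_P σ` with `f(1) = 0`.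
[cite: Casselman1995, §6.3] -/
theorem mem_evalJacquetKer_iff (x : (t.restrict (Representation.normalizedInd t σ)).Coinvariants) :
    x ∈ evalJacquetKer t σ hδ ↔
      ∃ f : Representation.SmoothInd t.P (Representation.twist (σ.comp t.proj) (rootDeltaChar t.P)),
        f.toFun 1 = 0 ∧ Representation.Coinvariants.mk _ f = x := by
  constructor
  · intro hx
    obtain ⟨f, rfl⟩ := Representation.Coinvariants.mk_surjective _ x
    exact ⟨f, by rwa [mem_evalJacquetKer_iff_apply, evalJacquet_mk] at hx, rfl⟩
  · rintro ⟨f, hf, rfl⟩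
    rw [mem_evalJacquetKer_iff_apply, evalJacquet_mk, hf]

/-- **A function of `i_P σ` vanishing at `1` vanishes on the closed cell `P`** (`f(p) = (σ ∘ proj ⊗ δ^{1/2})(p) f(1)`).
[cite: Casselman1995, §6.3] -/
theorem toFun_eq_zero_of_mem {f : Representation.SmoothInd t.P (Representation.twist (σ.comp t.proj) (rootDeltaChar t.P))}
    (hf : f.toFun 1 = 0) {p : G} (hp : p ∈ t.P) : f.toFun p = 0 := by
  rw [show p = ((⟨p, hp⟩ : t.P) : G) * 1 from (mul_one p).symm, Representation.SmoothInd.toFun_subgroup_mul, hf, map_zero]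

/-- `r ⧸ ℓ` embeds in `W`: it is finite-dimensional when `W` is. [cite: Casselman1995, Lemma 7.1.1 (a) p. 67] -/
theorem finiteDimensional_quotient_evalJacquetKer [FiniteDimensional ℂ W] :
    FiniteDimensional ℂ ((t.restrict (Representation.normalizedInd t σ)).Coinvariants ⧸ evalJacquetKer t σ hδ) :=
  Module.Finite.equiv ((evalJacquet t σ hδ).toLinearMap.quotKerEquivRange).symm

/-- **`dim (r ⧸ ℓ) ≤ dim W`** (`r ⧸ ℓ ≅ range ev ≤ W`). [cite: Casselman1995, Lemma 7.1.1 (a) p. 67]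
[cite: BernsteinZelevinsky1977, §2.12 Geometrical Lemma, Cor. 2.13 (c)] -/
theorem finrank_quotient_evalJacquetKer_le [FiniteDimensional ℂ W] :
    Module.finrank ℂ ((t.restrict (Representation.normalizedInd t σ)).Coinvariants ⧸ evalJacquetKer t σ hδ) ≤
      Module.finrank ℂ W := by
  have h1 : Module.finrank ℂ ((t.restrict (Representation.normalizedInd t σ)).Coinvariants ⧸ evalJacquetKer t σ hδ) =
      Module.finrank ℂ (LinearMap.range (evalJacquet t σ hδ).toLinearMap) :=
    LinearEquiv.finrank_eq (evalJacquet t σ hδ).toLinearMap.quotKerEquivRange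
  rw [h1]
  exact Submodule.finrank_le _

end Generic

/-! ### The character case `σ = 𝟙 ⊗ χ`: `M` acts on `r ⧸ ℓ` through `χ` -/

section Character

variable {G : Type*} [Group G] [TopologicalSpace G] [IsTopologicalGroup G]
  (t : ParabolicTriple G) [LocallyCompactSpace t.P]
  {W : Type*} [AddCommGroup W] [Module ℂ W] (σ : Representation ℂ t.M W)
  (hδ : ∀ (n : G) (hn : n ∈ t.N), deltaChar t.P ⟨n, t.N_le hn⟩ = 1)

/-- **`M` acts on `r_P (i_P χ) ⧸ ℓ` through `χ`** when `σ` is the character `χ` (`σ(m) = χ(m) • id`, e.g. `σ = 𝟙 ⊗ χ`):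
`r(m) x − χ(m) • x ∈ ℓ` for every `m ∈ M` and every class `x` (the closed-cell quotient of the geometric lemma is `χ` in
normalised terms — print's `σ δ_P^{1/2}` unnormalised).
[cite: Casselman1995, Lemma 7.1.1 (a) p. 67] [cite: BernsteinZelevinsky1977, §2.12 Geometrical Lemma, Cor. 2.13 (c)] -/
theorem normalizedJacquet_sub_smul_mem_evalJacquetKer (χ : t.M →* ℂˣ) (hσ : ∀ (m : t.M) (w : W), σ m w = ((χ m : ℂˣ) : ℂ) • w)
    (m : t.M) (x : (t.restrict (Representation.normalizedInd t σ)).Coinvariants) :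
    (Representation.normalizedInd t σ).normalizedJacquet t m x - ((χ m : ℂˣ) : ℂ) • x ∈ evalJacquetKer t σ hδ := by
  rw [mem_evalJacquetKer_iff_apply, map_sub, map_smul, evalJacquet_normalizedJacquet, hσ, sub_self]

end Character

/-! ## §2 The CM instance: `r_B i_G(χ)` for `G = U(Φ₃)(L⁺_v)` — clauses (β) and the quotient half of (γ) of N1 -/

section CM

open _root_.NumberField _root_.IsDedekindDomain UnitaryGroup

variable (L : Type) [Field L] [NumberField L] [IsCMField L]

set_option synthInstance.maxHeartbeats 400000 in  -- as in the fact ★ N1 itself: instance paths on the CM carrier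
set_option maxHeartbeats 2000000 in  -- as in the fact ★ N1: ≈ 10⁶ beats per application across the CM Borel triple
/-- **CLOSED-CELL HALF OF N1 for `U(3)`, `normalizedInd` spelling** (any finite place `v` of `L⁺`, any character `χ` of the
diagonal torus `T(L⁺_v)`): in the normalised Jacquet module `r := r_B i_G(χ)` of
`i_G(χ) = normalizedInd (cmBorelTriple L 3 v) (𝟙 ⊗ χ)` (= ★ `cmPrincipalSeries L 3 v χ` by `rfl`, next theorem) there is a
`T`-stable subspace `ℓ` (the kernel of evaluation at `1`, `evalJacquetKer`) such that `r(m) x − χ(m) • x ∈ ℓ` for all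
`m ∈ T`, `x ∈ r` (so `T` acts on `r ⧸ ℓ` through `χ`), `r ⧸ ℓ` is finite-dimensional of dimension `≤ 1`, and `ℓ` consists
exactly of the classes of the functions of `i_G(χ)` vanishing at `1` (equivalently, on `B`).  `δ_B|_N = 1` is ★
`deltaChar_cmBorel_eq_one`.  Towards ★ `U3PrincipalSeriesJacquetFiltration L` (clauses (β), (γ)-quotient; the bound
`dim ℓ ≤ 1` with the `wχ`-action = the open cell, and the lower bounds, are NOT in this file).
[cite: Casselman1995, Lemma 7.1.1 (a) p. 67; §6.3] [cite: BernsteinZelevinsky1977, §2.12 Geometrical Lemma, Cor. 2.13 (c)]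
[cite: Rogawski1990, §12.2 p. 173] -/
theorem closedCell_normalizedInd_cm (v : HeightOneSpectrum (𝓞 ↥(maximalRealSubfield L)))
    (χ : ↥(torusU (conjLocal L (IsCMField.complexConj L) v) (cmLocalForm L 3 v)) →* ℂˣ) :
    haveI := locallyCompactSpace_cmBorelU L 3 v
    ∃ ℓ : Submodule ℂ ((cmBorelTriple L 3 v).restrict (Representation.normalizedInd (cmBorelTriple L 3 v)
        ((Representation.trivial ℂ ↥(torusU (conjLocal L (IsCMField.complexConj L) v) (cmLocalForm L 3 v)) ℂ).twist χ))).Coinvariants,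
      (∀ (m : ↥(cmBorelTriple L 3 v).M), ∀ x ∈ ℓ,
        (Representation.normalizedInd (cmBorelTriple L 3 v)
          ((Representation.trivial ℂ ↥(torusU (conjLocal L (IsCMField.complexConj L) v) (cmLocalForm L 3 v)) ℂ).twist χ)).normalizedJacquet
            (cmBorelTriple L 3 v) m x ∈ ℓ) ∧
      (∀ (m : ↥(cmBorelTriple L 3 v).M) (x : ((cmBorelTriple L 3 v).restrict (Representation.normalizedInd (cmBorelTriple L 3 v)
          ((Representation.trivial ℂ ↥(torusU (conjLocal L (IsCMField.complexConj L) v) (cmLocalForm L 3 v)) ℂ).twist χ))).Coinvariants),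
        (Representation.normalizedInd (cmBorelTriple L 3 v)
          ((Representation.trivial ℂ ↥(torusU (conjLocal L (IsCMField.complexConj L) v) (cmLocalForm L 3 v)) ℂ).twist χ)).normalizedJacquet
            (cmBorelTriple L 3 v) m x - ((χ m : ℂˣ) : ℂ) • x ∈ ℓ) ∧
      FiniteDimensional ℂ (((cmBorelTriple L 3 v).restrict (Representation.normalizedInd (cmBorelTriple L 3 v)
        ((Representation.trivial ℂ ↥(torusU (conjLocal L (IsCMField.complexConj L) v) (cmLocalForm L 3 v)) ℂ).twist χ))).Coinvariants ⧸ ℓ) ∧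
      Module.finrank ℂ (((cmBorelTriple L 3 v).restrict (Representation.normalizedInd (cmBorelTriple L 3 v)
        ((Representation.trivial ℂ ↥(torusU (conjLocal L (IsCMField.complexConj L) v) (cmLocalForm L 3 v)) ℂ).twist χ))).Coinvariants ⧸ ℓ) ≤ 1 ∧
      (∀ x, x ∈ ℓ ↔ ∃ f : Representation.SmoothInd (cmBorelTriple L 3 v).P
          (Representation.twist
            (((Representation.trivial ℂ ↥(torusU (conjLocal L (IsCMField.complexConj L) v) (cmLocalForm L 3 v)) ℂ).twist
              χ).comp (cmBorelTriple L 3 v).proj) (rootDeltaChar (cmBorelTriple L 3 v).P)),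
        f.toFun 1 = 0 ∧ Representation.Coinvariants.mk _ f = x) := by
  haveI := locallyCompactSpace_cmBorelU L 3 v
  exact ⟨evalJacquetKer (cmBorelTriple L 3 v)
      ((Representation.trivial ℂ ↥(torusU (conjLocal L (IsCMField.complexConj L) v) (cmLocalForm L 3 v)) ℂ).twist χ)
      (F0P2nBorelCharactersUnipotent.deltaChar_cmBorel_eq_one L v),
    fun m x hx => normalizedJacquet_mem_evalJacquetKer (cmBorelTriple L 3 v)
      ((Representation.trivial ℂ ↥(torusU (conjLocal L (IsCMField.complexConj L) v) (cmLocalForm L 3 v)) ℂ).twist χ)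
      (F0P2nBorelCharactersUnipotent.deltaChar_cmBorel_eq_one L v) m hx,
    fun m x => normalizedJacquet_sub_smul_mem_evalJacquetKer (cmBorelTriple L 3 v)
      ((Representation.trivial ℂ ↥(torusU (conjLocal L (IsCMField.complexConj L) v) (cmLocalForm L 3 v)) ℂ).twist χ)
      (F0P2nBorelCharactersUnipotent.deltaChar_cmBorel_eq_one L v) χ
      (fun m w => by rw [Representation.twist_apply, Representation.trivial_apply]) m x,
    finiteDimensional_quotient_evalJacquetKer (cmBorelTriple L 3 v)
      ((Representation.trivial ℂ ↥(torusU (conjLocal L (IsCMField.complexConj L) v) (cmLocalForm L 3 v)) ℂ).twist χ)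
      (F0P2nBorelCharactersUnipotent.deltaChar_cmBorel_eq_one L v),
    (finrank_quotient_evalJacquetKer_le (cmBorelTriple L 3 v)
      ((Representation.trivial ℂ ↥(torusU (conjLocal L (IsCMField.complexConj L) v) (cmLocalForm L 3 v)) ℂ).twist χ)
      (F0P2nBorelCharactersUnipotent.deltaChar_cmBorel_eq_one L v)).trans (Module.finrank_self ℂ).le,
    fun x => mem_evalJacquetKer_iff (cmBorelTriple L 3 v)
      ((Representation.trivial ℂ ↥(torusU (conjLocal L (IsCMField.complexConj L) v) (cmLocalForm L 3 v)) ℂ).twist χ)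
      (F0P2nBorelCharactersUnipotent.deltaChar_cmBorel_eq_one L v) x⟩

set_option synthInstance.maxHeartbeats 400000 in  -- the ONE `rfl`-bridge `cmPrincipalSeries = normalizedInd …` (cf. ★ `F0P2nFrobeniusCmPrincipalSeries`)
set_option maxHeartbeats 2000000 in
/-- **CLOSED-CELL HALF OF N1 for `U(3)`, in the fact's spelling ★ `cmPrincipalSeries L 3 v χ`** (= `normalizedInd (cmBorelTriple L 3 v) (𝟙 ⊗ χ)`
definitionally; the previous theorem transported along that `rfl`): a `T`-stable `ℓ ≤ r_B i_G(χ)` with `r(m) x − χ(m) • x ∈ ℓ`,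
`FiniteDimensional (r ⧸ ℓ)`, `finrank (r ⧸ ℓ) ≤ 1`, `ℓ` = the classes of the functions vanishing at `1`.
[cite: Casselman1995, Lemma 7.1.1 (a) p. 67; §6.3] [cite: BernsteinZelevinsky1977, §2.12 Geometrical Lemma, Cor. 2.13 (c)]
[cite: Rogawski1990, §12.2 p. 173] -/
theorem closedCell_cmPrincipalSeries (v : HeightOneSpectrum (𝓞 ↥(maximalRealSubfield L)))
    (χ : ↥(torusU (conjLocal L (IsCMField.complexConj L) v) (cmLocalForm L 3 v)) →* ℂˣ) :
    haveI := locallyCompactSpace_cmBorelU L 3 v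
    ∃ ℓ : Submodule ℂ ((cmBorelTriple L 3 v).restrict (cmPrincipalSeries L 3 v χ)).Coinvariants,
      (∀ (m : ↥(cmBorelTriple L 3 v).M), ∀ x ∈ ℓ,
        (cmPrincipalSeries L 3 v χ).normalizedJacquet (cmBorelTriple L 3 v) m x ∈ ℓ) ∧
      (∀ (m : ↥(cmBorelTriple L 3 v).M) (x : ((cmBorelTriple L 3 v).restrict (cmPrincipalSeries L 3 v χ)).Coinvariants),
        (cmPrincipalSeries L 3 v χ).normalizedJacquet (cmBorelTriple L 3 v) m x - ((χ m : ℂˣ) : ℂ) • x ∈ ℓ) ∧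
      FiniteDimensional ℂ (((cmBorelTriple L 3 v).restrict (cmPrincipalSeries L 3 v χ)).Coinvariants ⧸ ℓ) ∧
      Module.finrank ℂ (((cmBorelTriple L 3 v).restrict (cmPrincipalSeries L 3 v χ)).Coinvariants ⧸ ℓ) ≤ 1 ∧
      (∀ x, x ∈ ℓ ↔ ∃ f : Representation.SmoothInd (cmBorelTriple L 3 v).P
          (Representation.twist
            (((Representation.trivial ℂ ↥(torusU (conjLocal L (IsCMField.complexConj L) v) (cmLocalForm L 3 v)) ℂ).twist
              χ).comp (cmBorelTriple L 3 v).proj) (rootDeltaChar (cmBorelTriple L 3 v).P)),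
        f.toFun 1 = 0 ∧ Representation.Coinvariants.mk _ f = x) :=
  closedCell_normalizedInd_cm L v χ

end CM

end Summit.HodgeConjecture.HodgeConjecture.Cruxes.H413.F0P3U3PrincipalSeriesJacquetClosedCell

end
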